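import Summits.QuantumAdvantage.QuantumAdvantage.Theses.XorDarkCharacters
import Literature.Computability.AlgebraicComplexity.BurgisserBooleanPartsModPCircuits

/-!
# Route `XorDarkCharacters`, support `ResonantCells` (stmt-QuantumAdvantage-9872)

(i) The carry identity `x + (x ⊕ a) = a + 2·(x ∧ ā)` for `x, a < 2ⁿ`, `ā = (2ⁿ − 1) ⊕ a` (from the
tree's `x + y = (x ⊕ y) + 2(x ∧ y)` — `Literature.Computability.AlgebraicComplexity.add_eq_xor_add_two_mul_and`
— with `y = x ⊕ a`, and `x ∧ (x ⊕ a) = x ∧ ā`).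
(ii) Hence a resonant `x` (`0 < x < p`, `x ⊕ a < p`, `x + (x ⊕ a) ≡ 0 (mod p)`, where `2ⁿ⁻¹ < p < 2ⁿ`)
has `x + (x ⊕ a) = p` exactly (the sum lies in `(0, 2p)`), so `x ∧ ā = (p − a)/2` is determined; `x` is
then determined by its bits on the support of `a`, whence at most `2^{popcount a} ≤ 2·2^{popcount a}`
resonant `x`.

HONEST FRAMING (block-2b rule): the value here is a closed ledger item (an elementary kernel-checked
lemma), NOT summit progress.

References: elementary; planner NOTES.md §audit 2 of route `XorDarkCharacters`. [folklore]
-/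

set_option linter.dupNamespace false -- D-0017: single-problem summit ⇒ `QuantumAdvantage.QuantumAdvantage` by design

namespace Summit.QuantumAdvantage.QuantumAdvantage.Theorems.ResonantCells

open Finset

/-- `x ∧ (x ⊕ a) = x ∧ ā` with `ā = (2ⁿ − 1) ⊕ a`, for `x < 2ⁿ`. [folklore] -/
theorem and_xor_self_eq {n x : ℕ} (a : ℕ) (hx : x < 2 ^ n) :
    x &&& (x ^^^ a) = x &&& ((2 ^ n - 1) ^^^ a) := by
  refine Nat.eq_of_testBit_eq fun i => ?_
  simp only [Nat.testBit_and, Nat.testBit_xor, Nat.testBit_two_pow_sub_one]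
  cases hxi : x.testBit i
  · simp
  · have hin : i < n := by
      by_contra h
      have : x < 2 ^ i := lt_of_lt_of_le hx (Nat.pow_le_pow_right (by norm_num) (not_lt.1 h))
      rw [Nat.testBit_lt_two_pow this] at hxi
      exact Bool.false_ne_true hxi
    simp [hin]

/-- Part (i): `x + (x ⊕ a) = a + 2·(x ∧ ā)` for `x, a < 2ⁿ`. [folklore] -/
theorem add_xor_eq {n x a : ℕ} (hx : x < 2 ^ n) :
    x + (x ^^^ a) = a + 2 * (x &&& ((2 ^ n - 1) ^^^ a)) := by
  rw [Literature.Computability.AlgebraicComplexity.add_eq_xor_add_two_mul_and, ← Nat.xor_assoc, Nat.xor_self, Nat.zero_xor, and_xor_self_eq a hx]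

/-- A resonant `x` has `x + (x ⊕ a) = p` on the nose. [folklore] -/
theorem add_xor_eq_of_resonant {p x a : ℕ} (hx0 : 0 < x) (hxp : x < p) (hxap : x ^^^ a < p)
    (hmod : (x + (x ^^^ a)) % p = 0) : x + (x ^^^ a) = p := by
  obtain ⟨k, hk⟩ := Nat.dvd_of_mod_eq_zero hmod
  have hlt : x + (x ^^^ a) < 2 * p := by omega
  have hk1 : k = 1 := by
    rcases Nat.lt_or_ge k 2 with h | h
    · interval_cases k
      · omega
      · rfl
    · nlinarith
  rw [hk, hk1, mul_one]

/-- **`XorDarkCharacters.ResonantCells`** (stmt-QuantumAdvantage-9872). [folklore] -/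
theorem resonantCells_proof :
    Summit.QuantumAdvantage.QuantumAdvantage.Theses.XorDarkCharacters.ResonantCells := by
  unfold Summit.QuantumAdvantage.QuantumAdvantage.Theses.XorDarkCharacters.ResonantCells
  refine ⟨fun n x a hx _ => add_xor_eq hx, ?_⟩
  intro p n a hpn hp ha0 ha
  classical
  set S := (range p).filter fun x => 0 < x ∧ x ^^^ a < p ∧ (x + (x ^^^ a)) % p = 0 with hS
  set A := (range n).filter fun i => a.testBit i with hA
  -- every resonant `x` is `< 2ⁿ` and has the same `x ∧ ā`
  have hxlt : ∀ x ∈ S, x < 2 ^ n := fun x hx => by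
    have := Finset.mem_range.1 (Finset.mem_filter.1 hx).1
    omega
  have hw : ∀ x ∈ S, 2 * (x &&& ((2 ^ n - 1) ^^^ a)) + a = p := fun x hx => by
    obtain ⟨hxr, hx0, hxap, hmod⟩ := Finset.mem_filter.1 hx
    have h1 := add_xor_eq_of_resonant hx0 (Finset.mem_range.1 hxr) hxap hmod
    rw [add_xor_eq (a := a) (hxlt x hx)] at h1
    omega
  -- the injection into the subsets of the support of `a`
  let φ : ℕ → Finset ℕ := fun x => (range n).filter fun i => a.testBit i ∧ x.testBit i
  have hφ : ∀ x ∈ S, φ x ∈ A.powerset := fun x _ => by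
    rw [Finset.mem_powerset]
    intro i hi
    rw [Finset.mem_filter] at hi ⊢
    exact ⟨hi.1, hi.2.1⟩
  have hinj : Set.InjOn φ S := by
    intro x hx x' hx' hxx'
    have hww : x &&& ((2 ^ n - 1) ^^^ a) = x' &&& ((2 ^ n - 1) ^^^ a) := by
      have h1 := hw x hx; have h2 := hw x' hx'; omega
    refine Nat.eq_of_testBit_eq fun i => ?_
    rcases Nat.lt_or_ge i n with hin | hin
    · cases hai : a.testBit i
      · -- off the support of `a`: read the bit from `x ∧ ā`
        have := congrArg (fun m => m.testBit i) hww
        simpa [Nat.testBit_and, Nat.testBit_xor, Nat.testBit_two_pow_sub_one, hin, hai] using this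
      · -- on the support of `a`: read the bit from `φ`
        have h1 : i ∈ φ x ↔ i ∈ φ x' := by rw [hxx']
        simp only [φ, Finset.mem_filter, Finset.mem_range, hin, hai, true_and] at h1
        cases h : x.testBit i <;> cases h' : x'.testBit i <;> simp_all
    · have h2i : 2 ^ n ≤ 2 ^ i := Nat.pow_le_pow_right (by norm_num) hin
      rw [Nat.testBit_lt_two_pow ((hxlt x hx).trans_le h2i),
        Nat.testBit_lt_two_pow ((hxlt x' hx').trans_le h2i)]
  calc S.card ≤ A.powerset.card := Finset.card_le_card_of_injOn φ hφ hinj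
    _ = 2 ^ A.card := Finset.card_powerset A
    _ ≤ 2 * 2 ^ A.card := by omega

end Summit.QuantumAdvantage.QuantumAdvantage.Theorems.ResonantCells
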